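import Summits.Ventures.CertifiedManyBodySolver.Downfold.EmeryThermalSeam
import Literature.MathematicalPhysics.QuantumLattice.EmeryThreeBandBlock2x2RayleighCap
import HarnessLib

/-!
# The T = 0 CAP ORDER in device form: ONE `N`-particle unit vector of the open `Cu₄O₈` block with its fourteen EXACT per-atom traces ⇒ the
# three-band energy CAP word on a typed Emery box (closed form), the min over several vectors, and the La₂CuO₄ WINDOW door at ρ = 5/4

Venture CertifiedManyBodySolver, cell `pub/hubbard-downfold` (S1 = ROUTER) × crew hubbard-fast S2 (iv); seat hubbard-downfold-mod-4 (S1/S2 Emery seam). Namespace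
`Summit.Ventures.CertifiedManyBodySolver.Downfold`. hubbard-box-p1's `EmeryThreeBandBlock2x2RayleighCap` (p629882: `emeryEnergyDensity_le_block2x2_rayleigh θ hφN hφ1 :
e(θ, N/16) ≤ (1/16)·Σ_a θ_a·Re⟨φ, hubbardOpenBoxGP 1 12 (cu4o8Tau a) (cu4o8Ups a) (cu4o8Nu a) φ⟩`) + this seat's closed-form cap door (`EmeryClusterCapSeam`:
`holdsOn_emeryEnergyCap_of_affineCap`, `affineCapBound`) are composed here in EXACTLY the shape hubbard-box-p2 g15's announced device (B) «KLDL-R, sparse coded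
Rayleigh traces» delivers (hubbard-fast STATUS 13:39:20Z: `IsNParticle`, `‖φ‖² = 1`, rational traces):

* `rayleighCap_of_traces` — a unit `N`-particle block vector with exact traces `T a` gives the affine cap `e(θ, N/16) ≤ Σ_a θ_a·(T a/16)` at every `θ`;
* **`holdsOn_emeryEnergyCap_of_rayleighTraces`** — ⇒ on any typed Emery box: `e(emeryLine s (emeryLineCoords εp p), N/16) ≤ affineCapBound s (T/16) lo hi`;
* `holdsOn_le_min` — two cap words ⇒ the `min` cap word (use it pairwise for the four corner vectors: the box cap is the min of the four closed forms);
* La₂CuO₄ (`N = 20` ⇒ ρ = 5/4): **`emeryBoxLa214v123_cuprate_energyCap54_of_rayleighTraces`** and **`emeryBoxLa214v123_cuprate_energyWindow54_of_rayleighTraces`**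
  (the floor of record `5876123/5000000 ≤ e` ∧ the trace cap) on the printed v1.23 companion; copies on `emeryBoxLa214v122` by refinement.

Everything PROVED (0 sorry); no definition. HONEST SCOPE: doors; no vector, no number; the cap's quality is that of the vector (a corner ground vector is tight at its
corner and loose across the box by the trace slopes); SCREENING-GRADE objects; energy words only.
-/

noncomputable section

namespace Summit.Ventures.CertifiedManyBodySolver.Downfold

open NonemptyInterval Matrix Finset Literature.Probability.LatticeModels
open Literature.MathematicalPhysics.QuantumLattice Literature.Computation.Certificates ClusterLowerBound
open scoped BigOperators ComplexOrder

/-! ## §1 One vector ⇒ an affine cap ⇒ a box cap word -/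

/-- **Exact traces ⇒ the affine cap**: a unit `N`-particle vector `φ` of the `Cu₄O₈` block with `Re⟨φ, H^G_a φ⟩ = T a` gives
`e(θ, N/16) ≤ Σ_a θ_a · (T a / 16)` at every `θ`. [cite: Ruelle1969, §3.3] -/
theorem rayleighCap_of_traces {N : ℕ} {φ : Fock (Orb (Fin 1 ×ₗ Fin 12))} (hφN : IsNParticle N φ) (hφ1 : star φ ⬝ᵥ φ = 1) {T : Fin 14 → ℝ}
    (hT : ∀ a, (star φ ⬝ᵥ (hubbardOpenBoxGP 1 12 (cu4o8Tau a) (cu4o8Ups a) (cu4o8Nu a) *ᵥ φ)).re = T a) :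
    ∀ θ : Fin 14 → ℝ, emeryEnergyDensity θ ((N : ℝ) / 16) ≤ ∑ a, θ a * (T a / 16) := by
  intro θ
  have h := emeryEnergyDensity_le_block2x2_rayleigh θ hφN hφ1
  simp_rw [hT] at h
  refine h.trans (le_of_eq ?_)
  rw [Finset.mul_sum]
  exact Finset.sum_congr rfl fun a _ => by ring

/-- **THE T = 0 CAP ORDER IN DEVICE FORM.** On a typed Emery box with the five seam entries: one unit `N`-particle `Cu₄O₈` vector with exact per-atom traces `T`
⇒ `p ↦ e(emeryLine s (emeryLineCoords εp p), N/16) ≤ affineCapBound s (fun a => T a / 16) (emeryLo εp …) (emeryHi εp …)`. [cite: Ruelle1969, §3.3] -/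
theorem holdsOn_emeryEnergyCap_of_rayleighTraces {E : EmeryBox} {eA eB eD eUd eUp : Entry} {εp : ℚ}
    (hA : E .tpd = some eA) (hB : E .tpp = some eB) (hD : E .DeltaPd = some eD) (hUd : E .Udd = some eUd) (hUp : E .Upp = some eUp)
    (s : Fin 4 → ℝ) {N : ℕ} {φ : Fock (Orb (Fin 1 ×ₗ Fin 12))} (hφN : IsNParticle N φ) (hφ1 : star φ ⬝ᵥ φ = 1) {T : Fin 14 → ℝ}
    (hT : ∀ a, (star φ ⬝ᵥ (hubbardOpenBoxGP 1 12 (cu4o8Tau a) (cu4o8Ups a) (cu4o8Nu a) *ᵥ φ)).re = T a) :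
    HoldsOn (fun p : EmeryCoord → ℝ => emeryEnergyDensity (emeryLine s (emeryLineCoords (εp : ℝ) p)) ((N : ℝ) / 16) ≤
      affineCapBound s (fun a => T a / 16) (emeryLo εp eA eB eD eUd eUp) (emeryHi εp eA eB eD eUd eUp)) E :=
  holdsOn_emeryEnergyCap_of_affineCap hA hB hD hUd hUp s (rayleighCap_of_traces hφN hφ1 hT)

/-- **Two cap words ⇒ the `min` cap word** (pairwise: four corner vectors ⇒ the min of four closed forms). [folklore] -/
theorem holdsOn_le_min {E : EmeryBox} {f : (EmeryCoord → ℝ) → ℝ} {M₁ M₂ : ℝ}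
    (h₁ : HoldsOn (fun p => f p ≤ M₁) E) (h₂ : HoldsOn (fun p => f p ≤ M₂) E) : HoldsOn (fun p => f p ≤ min M₁ M₂) E :=
  fun p hp => le_min (h₁ p hp) (h₂ p hp)

/-- **A floor word and a cap word ⇒ the window word.** [folklore] -/
theorem holdsOn_window {E : EmeryBox} {f : (EmeryCoord → ℝ) → ℝ} {m M : ℝ}
    (h₁ : HoldsOn (fun p => m ≤ f p) E) (h₂ : HoldsOn (fun p => f p ≤ M) E) : HoldsOn (fun p => m ≤ f p ∧ f p ≤ M) E :=
  fun p hp => ⟨h₁ p hp, h₂ p hp⟩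

/-! ## §2 La₂CuO₄ (#18), ρ = 5/4 (`N = 20` electrons on the twelve block sites) -/

/-- **La₂CuO₄ CAP ORDER in device form** (v1.23 companion): one unit 20-particle `Cu₄O₈` vector with exact traces ⇒
`e(·, 5/4) ≤ affineCapBound cuprateSigns (T/16) lo hi` on `emeryBoxLa214v123` (`lo/hi` = its delivered six-box at εp = 0). [cite: Ruelle1969, §3.3] -/
theorem emeryBoxLa214v123_cuprate_energyCap54_of_rayleighTraces {φ : Fock (Orb (Fin 1 ×ₗ Fin 12))} (hφN : IsNParticle 20 φ) (hφ1 : star φ ⬝ᵥ φ = 1)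
    {T : Fin 14 → ℝ} (hT : ∀ a, (star φ ⬝ᵥ (hubbardOpenBoxGP 1 12 (cu4o8Tau a) (cu4o8Ups a) (cu4o8Nu a) *ᵥ φ)).re = T a) :
    HoldsOn (fun p : EmeryCoord → ℝ => emeryEnergyDensity (emeryLine cuprateSigns (emeryLineCoords 0 p)) (5 / 4) ≤
      affineCapBound cuprateSigns (fun a => T a / 16) (emeryLo 0 la214Emery_tpd la214Emery_tpp la214Emery_Delta la214Emery_Udd_v122 la214Emery_Upp_exact)
        (emeryHi 0 la214Emery_tpd la214Emery_tpp la214Emery_Delta la214Emery_Udd_v122 la214Emery_Upp_exact)) emeryBoxLa214v123 := by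
  have h := holdsOn_emeryEnergyCap_of_rayleighTraces (E := emeryBoxLa214v123) (εp := 0) emeryBoxLa214v123_entries.1 emeryBoxLa214v123_entries.2.1
    emeryBoxLa214v123_entries.2.2.1 emeryBoxLa214v123_entries.2.2.2.1 emeryBoxLa214v123_entries.2.2.2.2.1 cuprateSigns hφN hφ1 hT
  have h20 : ((20 : ℕ) : ℝ) / 16 = 5 / 4 := by norm_num
  rw [h20] at h
  simpa using h

/-- **THE La₂CuO₄ TWO-SIDED WINDOW in device form**: the floor of record (`emeryBoxLa214v123_cuprate_energyFloor54`, hypothesis-free) ∧ the trace cap from ONE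
20-particle block vector ⇒ `5876123/5000000 ≤ e(·, 5/4) ≤ affineCapBound cuprateSigns (T/16) lo hi` on the whole v1.23 companion. [cite: Anderson1951, eq. (2)] [cite: Ruelle1969, §3.3] -/
theorem emeryBoxLa214v123_cuprate_energyWindow54_of_rayleighTraces {φ : Fock (Orb (Fin 1 ×ₗ Fin 12))} (hφN : IsNParticle 20 φ) (hφ1 : star φ ⬝ᵥ φ = 1)
    {T : Fin 14 → ℝ} (hT : ∀ a, (star φ ⬝ᵥ (hubbardOpenBoxGP 1 12 (cu4o8Tau a) (cu4o8Ups a) (cu4o8Nu a) *ᵥ φ)).re = T a) :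
    HoldsOn (fun p : EmeryCoord → ℝ =>
      (5876123 / 5000000 : ℝ) ≤ emeryEnergyDensity (emeryLine cuprateSigns (emeryLineCoords 0 p)) (5 / 4) ∧
        emeryEnergyDensity (emeryLine cuprateSigns (emeryLineCoords 0 p)) (5 / 4) ≤
          affineCapBound cuprateSigns (fun a => T a / 16) (emeryLo 0 la214Emery_tpd la214Emery_tpp la214Emery_Delta la214Emery_Udd_v122 la214Emery_Upp_exact)
            (emeryHi 0 la214Emery_tpd la214Emery_tpp la214Emery_Delta la214Emery_Udd_v122 la214Emery_Upp_exact)) emeryBoxLa214v123 :=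
  holdsOn_window emeryBoxLa214v123_cuprate_energyFloor54 (emeryBoxLa214v123_cuprate_energyCap54_of_rayleighTraces hφN hφ1 hT)

/-- **Copy of the cap order on the v1.22 companion of record** (by refinement v1.22 ⊑ v1.23; the closed form is read on the v1.23 six-box). [cite: Ruelle1969, §3.3] -/
theorem emeryBoxLa214v122_cuprate_energyCap54_of_rayleighTraces {φ : Fock (Orb (Fin 1 ×ₗ Fin 12))} (hφN : IsNParticle 20 φ) (hφ1 : star φ ⬝ᵥ φ = 1)
    {T : Fin 14 → ℝ} (hT : ∀ a, (star φ ⬝ᵥ (hubbardOpenBoxGP 1 12 (cu4o8Tau a) (cu4o8Ups a) (cu4o8Nu a) *ᵥ φ)).re = T a) :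
    HoldsOn (fun p : EmeryCoord → ℝ => emeryEnergyDensity (emeryLine cuprateSigns (emeryLineCoords 0 p)) (5 / 4) ≤
      affineCapBound cuprateSigns (fun a => T a / 16) (emeryLo 0 la214Emery_tpd la214Emery_tpp la214Emery_Delta la214Emery_Udd_v122 la214Emery_Upp_exact)
        (emeryHi 0 la214Emery_tpd la214Emery_tpp la214Emery_Delta la214Emery_Udd_v122 la214Emery_Upp_exact)) emeryBoxLa214v122 :=
  holdsOn_emeryBoxLa214v122_of_v123 (emeryBoxLa214v123_cuprate_energyCap54_of_rayleighTraces hφN hφ1 hT)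

end Summit.Ventures.CertifiedManyBodySolver.Downfold

end
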